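import Summits.BirchSwinnertonDyer.BirchSwinnertonDyer.Theorems.KimAtThreeD7uTamagawaDefectDevissage
import HarnessLib

/-!
# The TAMAGAWA-DIVISIBLE bad places, XIII: the Tamagawa DEFECT at EVERY exponent —
# `3 ∣ c_ℓ ∧ Φ_ℓ[3^k] ⊆ 3Φ_ℓ ⇒ KS(E[3^k·3], 𝓕_{u-ℓ}^{(k)}, 𝒫) = 0` (Büyükboduk 2009 Cor. 2.8 / Thm. 3.1 / Cor. 3.3
# for `T₃E`, all reduction types), assembled by induction from the exponent-one defect
# (cell `bsd-addord`, seat w2-tamdiv gen 5; route W2 `KimAtThreeKolyvagin`, items 19562 / 19560, «TamDiv∞»)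

HONEST FRAMING: TOOL theorems (no definition, no named fact, no `sorry`); closes nothing by itself;
nothing is booked; BSD is not proved by any of this.  CONDITIONAL on the named binders of part IX
(`KimAtThreeD7uTamagawaDefect`: Poitou–Tate family `inv` at `3`, Tate's local Euler–Poincaré characteristic
`hEP`, the level-one prime choice `hprime` = Chebotarev / Sakamoto Cor. 5.5) and on the tower data of
n1011's all-depth dévissage (`TorsionLevel.apply_eq_zero_of_apply_eq_zero_allDepths`: no `Γ_ℚ`-fixed point on
any `E[3^j·3]`, (H.2)-shape cokernels for `τ`, canonical admissible Kolyvagin data `D j` on every `E[3^j·3]`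
with ONE prime set and ONE `η`) — every binder displayed, nothing hidden.

## What

* **`kolyvaginSystems_blochKatoUpdate_eq_bot`**: for `E/ℚ`, a finite `ℓ ∤ 3` with `3 ∣ c_ℓ` and
  `Φ_ℓ[3^k] ⊆ 3Φ_ℓ` (part X: automatic when the `3`-part of `Φ_ℓ` is cyclic of order `≥ 3^{k+1}`; by
  Kodaira–Néron `Φ_ℓ[3^∞]` is always cyclic), **`KS(E[3^k·3], 𝓕_{u-ℓ}^{(k)}, D k) = 0`**, where
  `𝓕_{u-ℓ}^{(k)}` is Mazur–Rubin's canonical structure on `E[3^k·3]` with [MR04]'s unramified condition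
  `𝓕_u(ℓ)_k = im(H¹_ur(ℚ_ℓ, T₃E) → H¹(ℚ_ℓ, E[3^k·3]))` at `ℓ` (Büyükboduk's `𝓕_{u-ℓ}` on `T/3^{k+1}`).
  Induction on `k`: base = part IX (`kolyvaginSystems_eq_bot_of_three_dvd_localTamagawaNumber`, core rank `0`
  at length one); step = part XII (`apply_eq_zero_blochKatoUpdate_succ`, n1011-p15's dévissage along
  `0 → E[3] → E[3^{k+1}·3] → E[3^k·3] → 0`) with the CARTESIAN input at `ℓ` from part XI and the `E[3]`-end
  read off the base through `E[3] = E[3^0·3]` (definitional).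
* **`isKolyvaginSystem_apply_eq_zero_of_le_blochKatoUpdate`**: hence every Kolyvagin system for any
  `𝓕₀ ≤ 𝓕_{u-ℓ}^{(k)}` — e.g. [MR04] Remark A.5's `𝓕_u`, for which seat gen 2 proved that the Kolyvagin
  derivative classes of a Kato-type Euler system of `T₃E` form a Kolyvagin system
  (`KimAtThreeD7uKolyvaginPairBlochKato`) — VANISHES in `H¹(ℚ, E[3^{k+1}])`: the Euler system's classes
  are divisible by `3^{k+1}` at every Kolyvagin level (Büyükboduk Cor. 3.3 «`κ^{Kato} ∈ 3ⁿ KS`» at finite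
  level, `n = k + 1 ≤ v₃(c_ℓ)`; the Kolyvagin-system form of the route's «TamDiv∞» for one Tamagawa prime).

What is NOT here: several Tamagawa primes at once (exponent `v₃(∏ c_ℓ)`); the passage from `KS = 0` at
finite level to `κ ∈ 3ⁿ KS(T₃E)` ([MR04] Thm. 5.2.10's freeness); Kurihara-number currency (the W2 port).
References: K. Büyükboduk, JNT 129 (2009) Prop. 2.7, Cor. 2.8, Thm. 3.1, Cor. 3.3; B. Mazur, K. Rubin,
Mem. AMS 799 (2004) Thm. 4.2.2, Prop. 6.2.6, App. A Remark A.5; R. Sakamoto, JTNB 36 (2024) Def. 3.5,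
Thm. 4.4, Cor. 5.5; K. Rubin, PCMI 18 (2011) Thm. 2.7.6.
-/

noncomputable section

-- the cell's Theorems namespace `Summit.BirchSwinnertonDyer.BirchSwinnertonDyer.…` repeats the summit name by design (D-0017)
set_option linter.dupNamespace false

open scoped Classical NumberField ContRepresentation
open Function Field NumberField IsDedekindDomain Module
open WeierstrassCurve Literature.NumberTheory.EllipticCurves Literature.NumberTheory.GaloisRepresentations
  Literature.NumberTheory.GaloisRepresentations.DiscreteGaloisModule Literature.NumberTheory.GaloisCohomology
open Summit.BirchSwinnertonDyer.Rank1Residual.GaloisImage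
open Summit.BirchSwinnertonDyer.Rank1Residual.GaloisImage.KSDevissage
open Summit.BirchSwinnertonDyer.Rank1Residual.GaloisImage.TorsionLevel
open Summit.BirchSwinnertonDyer.BirchSwinnertonDyer.Theorems.KimAtThreeD7uTamagawaCartesian
open Summit.BirchSwinnertonDyer.BirchSwinnertonDyer.Theorems.KimAtThreeD7uTamagawaDefect

namespace Summit.BirchSwinnertonDyer.BirchSwinnertonDyer.Theorems.KimAtThreeD7uTamagawaDefectDevissage

section Exponent

variable (W : WeierstrassCurve ℚ) [W.IsElliptic]

/-- Local notation: `𝓕_{u-ℓ}^{(j)}` = Mazur–Rubin's propagated structure on `E[3^j·3]` with its condition at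
`ℓ` replaced by [MR04]'s unramified condition `𝓕_u(ℓ)_j` (as in part XII). -/
local notation3 "𝓕uℓ[" W' ", " ℓ' ", " j ", " L' "]" =>
  Function.update (propagatedSelmerStructure W' 3 j) (Sum.inr ℓ')
    (blochKatoSelmerStructure 3 (tateTorsionDatum W' 3 j) L' (Sum.inr ℓ'))

/-! ### All exponents: `KS(E[3^k·3], 𝓕_{u-ℓ}^{(k)}, D k) = 0` by induction from the exponent-one defect -/

/-- **The Tamagawa defect at every exponent** (Büyükboduk 2009 Cor. 2.8 / Thm. 3.1 for `T₃E`, every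
reduction type; the Kolyvagin-system form of «TamDiv∞» at exponent `k + 1`).  `E/ℚ`; `ℓ ∤ 3` a finite place
with `3 ∣ c_ℓ` whose component group satisfies `Φ_ℓ[3^k] ⊆ 3Φ_ℓ` (`hΦ`: for the cyclic `3`-part of `Φ_ℓ`
this is `3^{k+1} ∣ c_ℓ`, part X); the binders of part IX's exponent-one defect (Poitou–Tate family `inv` at
`3`, Tate's local Euler characteristic `hEP`, `T ⊇ {3} ∪ {bad}`, the level-one prime choice `hprime` on
`E[3^0·3]`) and the tower data of n1011's all-depth dévissage (no `Γ_ℚ`-fixed point on any `E[3^j·3]`;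
`τ` with (H.2)-shape cokernels at every level, in `Gal(ℚ̄/ℚ(μ_{3^{k+1}}))`; canonical admissible Kolyvagin
data `D j` on `E[3^j·3]` for EVERY `j` with ONE prime set `P ⊆ 𝒫_{3^{k+1}}` avoiding `T` and ONE `η`,
cyclotomic transverse conditions).  THEN every Kolyvagin system of
`(E[3^k·3], 𝓕_{u-ℓ}^{(k)}, D k)` vanishes: **`KS(E[3^k·3], 𝓕_{u-ℓ}^{(k)}, D k) = 0`**, where `𝓕_{u-ℓ}^{(k)}` is
the canonical structure with [MR04]'s unramified condition `𝓕_u(ℓ)_k` at `ℓ`.  Base `k = 0`: part IX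
(`kolyvaginSystems_eq_bot_of_three_dvd_localTamagawaNumber`, core rank `0`); step: §2 with the cartesian input
of part XI at `ℓ` and the E[3]-end supplied by the base through `E[3] = E[3^0·3]`.
[cite: Buyukboduk2009TamagawaDefect, Cor. 2.8 and Thm. 3.1 (§§2.4, 3)] [cite: MazurRubin2004, Thm. 4.2.2, Prop. 6.2.6 and App. A Remark A.5] -/
theorem kolyvaginSystems_blochKatoUpdate_eq_bot [Finite (geomTorsion W ((3 : ℕ) : ℤ))]
    [Finite (geomTorsion W (((3 : ℕ) : ℤ) ^ 0 * ((3 : ℕ) : ℤ)))]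
    {inv : LocalInvariants ℚ 3}
    (hperf : inv.IsPerfect) (hsum : inv.SumLocalTermEqZero) (hcompl : inv.SelmerComplement)
    (hEP : ∀ v : HeightOneSpectrum (𝓞 ℚ), localEulerPoincareCharacteristic (v.adicCompletion ℚ))
    (T : Finset (HeightOneSpectrum (𝓞 ℚ)))
    (h3T : ∀ v : HeightOneSpectrum (𝓞 ℚ), ((3 : ℕ) : 𝓞 ℚ) ∈ v.asIdeal → v ∈ T)
    (hbadT : ∀ v : HeightOneSpectrum (𝓞 ℚ), ¬ W.HasGoodReductionAt v → v ∈ T)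
    {ℓ : HeightOneSpectrum (𝓞 ℚ)} (h3ℓ : ((3 : ℕ) : 𝓞 ℚ) ∉ ℓ.asIdeal)
    (hc : 3 ∣ (W.baseChange (ℓ.adicCompletion ℚ)).localTamagawaNumber (ℓ.adicCompletionIntegers ℚ))
    (L : (j : ℕ) → (tateTorsionDatum W 3 j).LocalConditionsAbove 3)
    (h0 : ∀ (j : ℕ) (P : geomTorsion W (((3 : ℕ) : ℤ) ^ j * ((3 : ℕ) : ℤ))),
      (∀ σ : absoluteGaloisGroup ℚ,
        W.torsionGaloisModule (((3 : ℕ) : ℤ) ^ j * ((3 : ℕ) : ℤ)) σ P = P) → P = 0)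
    {Sset : Set (HeightOneSpectrum (𝓞 ℚ))} {τ : absoluteGaloisGroup ℚ}
    (hτ : ∀ j : ℕ, Nonempty (cokerSubOne (W.torsionGaloisModule (((3 : ℕ) : ℤ) ^ j * ((3 : ℕ) : ℤ))) τ ≃+
      ZMod (3 ^ (j + 1))))
    (hτ₁ : Nonempty (cokerSubOne (W.torsionGaloisModule ((3 : ℕ) : ℤ)) τ ≃+ ZMod 3))
    (D : (j : ℕ) → KolyvaginDatum (W.torsionGaloisModule (((3 : ℕ) : ℤ) ^ j * ((3 : ℕ) : ℤ))))
    {P : Set (HeightOneSpectrum (𝓞 ℚ))} (hP : ∀ j, (D j).primes = P) (hPT : ∀ q ∈ P, q ∉ T)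
    (hT : ∀ j, (D j).transverse = cyclotomicTransverse _)
    {η : (q : HeightOneSpectrum (𝓞 ℚ)) → (ZMod (Ideal.absNorm q.asIdeal))ˣ}
    (hD : ∀ j, (D j).HasCanonicalComparison (3 ^ (j + 1)) η) (hadm : ∀ j, (D j).IsAdmissible)
    (hprime : ∀ c : galoisCohomology (W.torsionGaloisModule (((3 : ℕ) : ℤ) ^ 0 * ((3 : ℕ) : ℤ))) 1, c ≠ 0 →
      ∀ c' : galoisCohomology (DiscreteGaloisModule.tateDual
        (W.torsionGaloisModule (((3 : ℕ) : ℤ) ^ 0 * ((3 : ℕ) : ℤ))) 3) 1, c' ≠ 0 →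
      {q ∈ (D 0).primes |
        galoisCohomology.localization (W.torsionGaloisModule (((3 : ℕ) : ℤ) ^ 0 * ((3 : ℕ) : ℤ)))
          (Sum.inr q) 1 c ≠ 0 ∧
        galoisCohomology.localization (DiscreteGaloisModule.tateDual
          (W.torsionGaloisModule (((3 : ℕ) : ℤ) ^ 0 * ((3 : ℕ) : ℤ))) 3) (Sum.inr q) 1 c' ≠ 0}.Infinite)
    (k : ℕ)
    (hΦ : ∀ φ : ((W.localMinimalIntegralModel ℓ).baseChange (ℓ.adicCompletion ℚ)).toAffine.Point ⧸
        (W.localMinimalIntegralModel ℓ).nonsingularReductionSubgroup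
          (integers_valuationRing_valuation (ℓ.adicCompletionIntegers ℚ) (ℓ.adicCompletion ℚ)),
      3 ^ k • φ = 0 → ∃ ψ : ((W.localMinimalIntegralModel ℓ).baseChange (ℓ.adicCompletion ℚ)).toAffine.Point ⧸
        (W.localMinimalIntegralModel ℓ).nonsingularReductionSubgroup
          (integers_valuationRing_valuation (ℓ.adicCompletionIntegers ℚ) (ℓ.adicCompletion ℚ)),
        3 • ψ = φ)
    (hτμ : τ ∈ rootsOfUnityFixer ℚ (3 ^ (k + 1)))
    (hPc : P ⊆ frobeniusClassPrimes
      (W.torsionGaloisModule (((3 : ℕ) : ℤ) ^ k * ((3 : ℕ) : ℤ))) Sset τ (3 ^ (k + 1))) :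
    (D k).kolyvaginSystems 𝓕uℓ[W, ℓ, k, L k] = ⊥ := by
  haveI : Fact (Nat.Prime 3) := ⟨Nat.prime_three⟩
  -- `S = S(T)`; `ℓ ∈ T` (bad, since `c_ℓ ≠ 1`); the structures are unramified outside `S`
  have h3S : ∀ v : HeightOneSpectrum (𝓞 ℚ), ((3 : ℕ) : 𝓞 ℚ) ∈ v.asIdeal → (Sum.inr v : Place ℚ) ∈ finSupport T :=
    fun v hv => (inr_mem_finSupport_iff T v).mpr (h3T v hv)
  have hbadS : ∀ v : HeightOneSpectrum (𝓞 ℚ), ¬ W.HasGoodReductionAt v → (Sum.inr v : Place ℚ) ∈ finSupport T :=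
    fun v hv => (inr_mem_finSupport_iff T v).mpr (hbadT v hv)
  have h𝓕 : ∀ j : ℕ, (propagatedSelmerStructure W 3 j).IsUnramifiedOutside (finSupport T) := fun j =>
    propagatedSelmerStructure_isUnramifiedOutside W 3 j (finSupport T) (inl_mem_finSupport T) h3S hbadS
  have h𝓕₁ : (propagatedSelmerStructureOne W 3).IsUnramifiedOutside (finSupport T) := h𝓕 0
  have hℓT : ℓ ∈ T := by
    refine hbadT ℓ fun hgood => ?_
    have h1 := localTamagawaNumber_eq_one_of_good_holds W ℓ hgood
    rw [h1] at hc
    exact absurd (Nat.dvd_one.mp hc) (by norm_num)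
  have hℓS : (Sum.inr ℓ : Place ℚ) ∈ finSupport T := (inr_mem_finSupport_iff T ℓ).mpr hℓT
  have hPS : ∀ j, ∀ q ∈ (D j).primes, (Sum.inr q : Place ℚ) ∉ finSupport T := fun j q hq h =>
    hPT q ((hP j) ▸ hq) ((inr_mem_finSupport_iff T q).mp h)
  -- BASE (part IX): `KS(E[3^0·3], 𝓕_{u-ℓ}^{(0)}, D 0) = 0` whenever `P ⊆ 𝒫_3`
  have hbase : P ⊆ frobeniusClassPrimes (W.torsionGaloisModule (((3 : ℕ) : ℤ) ^ 0 * ((3 : ℕ) : ℤ))) Sset τ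
      (3 ^ (0 + 1)) → τ ∈ rootsOfUnityFixer ℚ (3 ^ (0 + 1)) →
      (D 0).kolyvaginSystems 𝓕uℓ[W, ℓ, 0, L 0] = ⊥ := by
    intro hPc₀ hτμ₀
    have hprimeq : ∀ q : HeightOneSpectrum (𝓞 ℚ), Fact (Ideal.absNorm q.asIdeal).Prime :=
      fun q => ⟨FSComp.prime_absNorm_rat q⟩
    have hne : ∀ q : HeightOneSpectrum (𝓞 ℚ),
        NeZero ((Ideal.absNorm q.asIdeal : ℕ) : q.adicCompletion ℚ) := fun q => by
      haveI : CharZero (q.adicCompletion ℚ) :=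
        charZero_of_injective_algebraMap (algebraMap ℚ (q.adicCompletion ℚ)).injective
      exact ⟨Nat.cast_ne_zero.2 (FSComp.prime_absNorm_rat q).ne_zero⟩
    have hM₀ : ∀ m : geomTorsion W (((3 : ℕ) : ℤ) ^ 0 * ((3 : ℕ) : ℤ)), 3 ^ (0 + 1) • m = 0 :=
      pow_succ_nsmul_geomTorsion_eq_zero W 3 0
    have hq₀ : ∀ q ∈ (D 0).primes, q ∈ frobeniusClassPrimes
        (W.torsionGaloisModule (((3 : ℕ) : ℤ) ^ 0 * ((3 : ℕ) : ℤ))) Sset τ (3 ^ (0 + 1)) :=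
      fun q hq => hPc₀ ((hP 0) ▸ hq)
    have hM₀' : ∀ q ∈ (D 0).primes, ∀ m : geomTorsion W (((3 : ℕ) : ℤ) ^ 0 * ((3 : ℕ) : ℤ)),
        (Ideal.absNorm q.asIdeal - 1) • m = 0 := fun q hq =>
      absNorm_sub_one_smul_eq_zero_of_mem_frobeniusClassPrimes _ (hq₀ q hq) hτμ₀ hM₀
    refine kolyvaginSystems_eq_bot_of_three_dvd_localTamagawaNumber W hperf hsum hcompl hEP T h3T hbadT
      h3ℓ hc (L 0) (𝓕₀ := 𝓕uℓ[W, ℓ, 0, L 0]) (fun v => ?_) ?_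
      (fun q hq => hPT q ((hP 0) ▸ hq)) (hadm 0) (fun q hq => ?_) (fun q hq => ?_) (fun q hq => ?_) hprime
    · -- `𝓕_{u-ℓ}^{(0)} ≤ 𝓕_can`
      by_cases hv : v = Sum.inr ℓ
      · subst hv
        rw [update_inr_apply_self]
        exact KimAtThreeD7uBlochKatoCondition.blochKatoSelmerStructure_inr_le_propagatedSelmerStructure
          W 3 0 ℓ (L 0) h3ℓ
      · rw [update_inr_apply_of_ne _ ℓ _ hv]
    · rw [update_inr_apply_self]
    · have h := natCard_unramifiedSubgroup_toLocal_of_mem_frobeniusClassPrimes _ (hq₀ q hq) (hτ 0)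
      simpa using h
    · haveI := hprimeq q; haveI := hne q
      rw [hT 0]
      have h := natCard_cyclotomicTransverse_rat_of_mem_frobeniusClassPrimes' _ (hq₀ q hq) (hτ 0) (hM₀' q hq)
      simpa using h
    · haveI := hprimeq q; haveI := hne q
      rw [hT 0]
      exact unramifiedSubgroup_sup_cyclotomicTransverse_eq_top_of_mem_frobeniusClassPrimes _ (hq₀ q hq)
        (hM₀' q hq) (modPCyclotomicCharacter_surjOn_absInertia_rat_holds q)
  -- INDUCTION on `k`
  induction k with
  | zero => exact hbase hPc hτμ
  | succ k ih =>
    have hdvd : 3 ^ (k + 1) ∣ 3 ^ (k + 1 + 1) := pow_dvd_pow 3 (Nat.le_succ _)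
    have hdvd₀ : 3 ^ (0 + 1) ∣ 3 ^ (k + 1 + 1) := pow_dvd_pow 3 (by omega)
    have hker : ∀ u : absoluteGaloisGroup ℚ,
        W.torsionGaloisModule (((3 : ℕ) : ℤ) ^ (k + 1) * ((3 : ℕ) : ℤ)) u = 1 →
          W.torsionGaloisModule (((3 : ℕ) : ℤ) ^ k * ((3 : ℕ) : ℤ)) u = 1 := fun u hu =>
      torsionGaloisModule_eq_one_of_dvd W (Transport.pow_mul_dvd_pow_mul (Nat.le_succ k)) u hu
    have hker₀ : ∀ u : absoluteGaloisGroup ℚ,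
        W.torsionGaloisModule (((3 : ℕ) : ℤ) ^ (k + 1) * ((3 : ℕ) : ℤ)) u = 1 →
          W.torsionGaloisModule (((3 : ℕ) : ℤ) ^ 0 * ((3 : ℕ) : ℤ)) u = 1 := fun u hu =>
      torsionGaloisModule_eq_one_of_dvd W (Transport.pow_mul_dvd_pow_mul (Nat.zero_le (k + 1))) u hu
    have hPc' : P ⊆ frobeniusClassPrimes (W.torsionGaloisModule (((3 : ℕ) : ℤ) ^ k * ((3 : ℕ) : ℤ)))
        Sset τ (3 ^ (k + 1)) := fun q hq =>
      S24Deep.frobeniusClassPrimes_mono _ _ hker Sset τ hdvd (hPc hq)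
    have hPc₀ : P ⊆ frobeniusClassPrimes (W.torsionGaloisModule (((3 : ℕ) : ℤ) ^ 0 * ((3 : ℕ) : ℤ)))
        Sset τ (3 ^ (0 + 1)) := fun q hq =>
      S24Deep.frobeniusClassPrimes_mono _ _ hker₀ Sset τ hdvd₀ (hPc hq)
    have hτμ' : τ ∈ rootsOfUnityFixer ℚ (3 ^ (k + 1)) := rootsOfUnityFixer_le_of_dvd ℚ hdvd hτμ
    have hτμ₀ : τ ∈ rootsOfUnityFixer ℚ (3 ^ (0 + 1)) := rootsOfUnityFixer_le_of_dvd ℚ hdvd₀ hτμ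
    have hΦ' : ∀ φ : ((W.localMinimalIntegralModel ℓ).baseChange (ℓ.adicCompletion ℚ)).toAffine.Point ⧸
        (W.localMinimalIntegralModel ℓ).nonsingularReductionSubgroup
          (integers_valuationRing_valuation (ℓ.adicCompletionIntegers ℚ) (ℓ.adicCompletion ℚ)),
        3 ^ k • φ = 0 → ∃ ψ : ((W.localMinimalIntegralModel ℓ).baseChange (ℓ.adicCompletion ℚ)).toAffine.Point ⧸
          (W.localMinimalIntegralModel ℓ).nonsingularReductionSubgroup
            (integers_valuationRing_valuation (ℓ.adicCompletionIntegers ℚ) (ℓ.adicCompletion ℚ)),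
          3 • ψ = φ := fun φ hφ => hΦ φ (by rw [pow_succ, mul_comm, mul_smul, hφ, smul_zero])
    -- the two ends: `E[3^k·3]` by induction, `E[3] = E[3^0·3]` by the base
    have h₃ := ih hΦ' hτμ' hPc'
    have h₀ := hbase hPc₀ hτμ₀
    -- the E[3]-end, read on `W.torsionGaloisModule 3` (definitionally `E[3^0·3]`)
    let F₁ : AddSubgroup (galoisCohomology ((W.torsionGaloisModule ((3 : ℕ) : ℤ)).toLocal (Sum.inr ℓ)) 1) :=
      @id (AddSubgroup (galoisCohomology ((W.torsionGaloisModule ((3 : ℕ) : ℤ)).toLocal (Sum.inr ℓ)) 1))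
        (blochKatoSelmerStructure 3 (tateTorsionDatum W 3 0) (L 0) (Sum.inr ℓ))
    have h₁ : ∀ lam : Finset (HeightOneSpectrum (𝓞 ℚ)) →
        galoisCohomology (W.torsionGaloisModule ((3 : ℕ) : ℤ)) 1,
        (D 0).IsKolyvaginSystem (Function.update (propagatedSelmerStructureOne W 3) (Sum.inr ℓ) F₁) lam →
          ∀ n, lam n = 0 := by
      intro lam hlam n
      have hmem : lam ∈ (D 0).kolyvaginSystems 𝓕uℓ[W, ℓ, 0, L 0] :=
        (KolyvaginDatum.mem_kolyvaginSystems_iff (D 0) 𝓕uℓ[W, ℓ, 0, L 0] lam).2 hlam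
      exact congrFun ((AddSubgroup.eq_bot_iff_forall _).mp h₀ lam hmem) n
    refine (AddSubgroup.eq_bot_iff_forall _).mpr fun κ hκ => funext fun n => ?_
    rw [Pi.zero_apply]
    exact apply_eq_zero_blochKatoUpdate_succ W k (h0 k) (h𝓕 (k + 1)) h𝓕₁ h3ℓ hℓS (L (k + 1)) (L k) F₁
      (fun x hx => mem_blochKatoSelmerStructure_of_localMap_torsionInclusion_mem_of_componentQuotient W 3
        (k + 1) ℓ h3ℓ (L 0) (L (k + 1)) hΦ x hx)
      hτμ (hτ (k + 1)) (hτ k) hτ₁ (D₁ := D 0) ((hP 0).trans (hP (k + 1)).symm)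
      ((hP k).trans (hP (k + 1)).symm) (by rw [hP (k + 1)]; exact hPc) (hPS (k + 1)) (hT (k + 1)) (hT k)
      (hT 0) (hD (k + 1)) (hD k) (hD 0) (hadm (k + 1)) h₁
      (fun μ hμ m => congrFun ((AddSubgroup.eq_bot_iff_forall _).mp h₃ μ
        ((KolyvaginDatum.mem_kolyvaginSystems_iff (D k) 𝓕uℓ[W, ℓ, k, L k] μ).2 hμ)) m)
      ((KolyvaginDatum.mem_kolyvaginSystems_iff _ _ _).1 hκ) n

/-- **Corollary: every Kolyvagin system for a structure `𝓕₀ ≤ 𝓕_{u-ℓ}^{(k)}` vanishes** — e.g. [MR04]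
Remark A.5's `𝓕_u = blochKatoSelmerStructure 3 (tateTorsionDatum W 3 k) (L k)`, for which seat gen 2 proved
that the derivative classes of a Kato-type Euler system form a Kolyvagin system
(`KimAtThreeD7uKolyvaginPairBlochKato`): every such class `κ_d` VANISHES in `H¹(ℚ, E[3^{k+1}])`, i.e. the
Euler system's classes are divisible by `3^{k+1}` at every Kolyvagin level — Büyükboduk's Cor. 3.3
«`κ^{Kato} ∈ 3^{k+1} KS`» at finite level, for every reduction type at `ℓ`.
[cite: Buyukboduk2009TamagawaDefect, Thm. 3.1 and Cor. 3.3 (§3)] [cite: MazurRubin2004, App. A Remark A.5 (p. 81)] -/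
theorem isKolyvaginSystem_apply_eq_zero_of_le_blochKatoUpdate [Finite (geomTorsion W ((3 : ℕ) : ℤ))]
    [Finite (geomTorsion W (((3 : ℕ) : ℤ) ^ 0 * ((3 : ℕ) : ℤ)))]
    {inv : LocalInvariants ℚ 3}
    (hperf : inv.IsPerfect) (hsum : inv.SumLocalTermEqZero) (hcompl : inv.SelmerComplement)
    (hEP : ∀ v : HeightOneSpectrum (𝓞 ℚ), localEulerPoincareCharacteristic (v.adicCompletion ℚ))
    (T : Finset (HeightOneSpectrum (𝓞 ℚ)))
    (h3T : ∀ v : HeightOneSpectrum (𝓞 ℚ), ((3 : ℕ) : 𝓞 ℚ) ∈ v.asIdeal → v ∈ T)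
    (hbadT : ∀ v : HeightOneSpectrum (𝓞 ℚ), ¬ W.HasGoodReductionAt v → v ∈ T)
    {ℓ : HeightOneSpectrum (𝓞 ℚ)} (h3ℓ : ((3 : ℕ) : 𝓞 ℚ) ∉ ℓ.asIdeal)
    (hc : 3 ∣ (W.baseChange (ℓ.adicCompletion ℚ)).localTamagawaNumber (ℓ.adicCompletionIntegers ℚ))
    (L : (j : ℕ) → (tateTorsionDatum W 3 j).LocalConditionsAbove 3)
    (h0 : ∀ (j : ℕ) (P : geomTorsion W (((3 : ℕ) : ℤ) ^ j * ((3 : ℕ) : ℤ))),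
      (∀ σ : absoluteGaloisGroup ℚ,
        W.torsionGaloisModule (((3 : ℕ) : ℤ) ^ j * ((3 : ℕ) : ℤ)) σ P = P) → P = 0)
    {Sset : Set (HeightOneSpectrum (𝓞 ℚ))} {τ : absoluteGaloisGroup ℚ}
    (hτ : ∀ j : ℕ, Nonempty (cokerSubOne (W.torsionGaloisModule (((3 : ℕ) : ℤ) ^ j * ((3 : ℕ) : ℤ))) τ ≃+
      ZMod (3 ^ (j + 1))))
    (hτ₁ : Nonempty (cokerSubOne (W.torsionGaloisModule ((3 : ℕ) : ℤ)) τ ≃+ ZMod 3))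
    (D : (j : ℕ) → KolyvaginDatum (W.torsionGaloisModule (((3 : ℕ) : ℤ) ^ j * ((3 : ℕ) : ℤ))))
    {P : Set (HeightOneSpectrum (𝓞 ℚ))} (hP : ∀ j, (D j).primes = P) (hPT : ∀ q ∈ P, q ∉ T)
    (hT : ∀ j, (D j).transverse = cyclotomicTransverse _)
    {η : (q : HeightOneSpectrum (𝓞 ℚ)) → (ZMod (Ideal.absNorm q.asIdeal))ˣ}
    (hD : ∀ j, (D j).HasCanonicalComparison (3 ^ (j + 1)) η) (hadm : ∀ j, (D j).IsAdmissible)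
    (hprime : ∀ c : galoisCohomology (W.torsionGaloisModule (((3 : ℕ) : ℤ) ^ 0 * ((3 : ℕ) : ℤ))) 1, c ≠ 0 →
      ∀ c' : galoisCohomology (DiscreteGaloisModule.tateDual
        (W.torsionGaloisModule (((3 : ℕ) : ℤ) ^ 0 * ((3 : ℕ) : ℤ))) 3) 1, c' ≠ 0 →
      {q ∈ (D 0).primes |
        galoisCohomology.localization (W.torsionGaloisModule (((3 : ℕ) : ℤ) ^ 0 * ((3 : ℕ) : ℤ)))
          (Sum.inr q) 1 c ≠ 0 ∧
        galoisCohomology.localization (DiscreteGaloisModule.tateDual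
          (W.torsionGaloisModule (((3 : ℕ) : ℤ) ^ 0 * ((3 : ℕ) : ℤ))) 3) (Sum.inr q) 1 c' ≠ 0}.Infinite)
    (k : ℕ)
    (hΦ : ∀ φ : ((W.localMinimalIntegralModel ℓ).baseChange (ℓ.adicCompletion ℚ)).toAffine.Point ⧸
        (W.localMinimalIntegralModel ℓ).nonsingularReductionSubgroup
          (integers_valuationRing_valuation (ℓ.adicCompletionIntegers ℚ) (ℓ.adicCompletion ℚ)),
      3 ^ k • φ = 0 → ∃ ψ : ((W.localMinimalIntegralModel ℓ).baseChange (ℓ.adicCompletion ℚ)).toAffine.Point ⧸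
        (W.localMinimalIntegralModel ℓ).nonsingularReductionSubgroup
          (integers_valuationRing_valuation (ℓ.adicCompletionIntegers ℚ) (ℓ.adicCompletion ℚ)),
        3 • ψ = φ)
    (hτμ : τ ∈ rootsOfUnityFixer ℚ (3 ^ (k + 1)))
    (hPc : P ⊆ frobeniusClassPrimes
      (W.torsionGaloisModule (((3 : ℕ) : ℤ) ^ k * ((3 : ℕ) : ℤ))) Sset τ (3 ^ (k + 1)))
    {𝓕₀ : SelmerStructure (W.torsionGaloisModule (((3 : ℕ) : ℤ) ^ k * ((3 : ℕ) : ℤ)))}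
    (h₀ : ∀ v : Place ℚ, v ≠ Sum.inr ℓ → 𝓕₀ v ≤ propagatedSelmerStructure W 3 k v)
    (h₀ℓ : 𝓕₀ (Sum.inr ℓ) ≤ blochKatoSelmerStructure 3 (tateTorsionDatum W 3 k) (L k) (Sum.inr ℓ))
    {κ : Finset (HeightOneSpectrum (𝓞 ℚ)) →
      galoisCohomology (W.torsionGaloisModule (((3 : ℕ) : ℤ) ^ k * ((3 : ℕ) : ℤ))) 1}
    (hκ : (D k).IsKolyvaginSystem 𝓕₀ κ) (d : Finset (HeightOneSpectrum (𝓞 ℚ))) : κ d = 0 := by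
  have hle : 𝓕₀ ≤ 𝓕uℓ[W, ℓ, k, L k] := by
    intro v
    by_cases hv : v = Sum.inr ℓ
    · subst hv; rw [update_inr_apply_self]; exact h₀ℓ
    · rw [update_inr_apply_of_ne _ ℓ _ hv]; exact h₀ v hv
  have h := kolyvaginSystems_blochKatoUpdate_eq_bot W hperf hsum hcompl hEP T h3T hbadT h3ℓ hc L h0 hτ hτ₁ D
    hP hPT hT hD hadm hprime k hΦ hτμ hPc
  have hκ' : κ ∈ (D k).kolyvaginSystems 𝓕uℓ[W, ℓ, k, L k] :=
    kolyvaginSystems_mono (D k) hle ((KolyvaginDatum.mem_kolyvaginSystems_iff _ _ _).2 hκ)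
  exact congrFun ((AddSubgroup.eq_bot_iff_forall _).mp h κ hκ') d

end Exponent

end Summit.BirchSwinnertonDyer.BirchSwinnertonDyer.Theorems.KimAtThreeD7uTamagawaDefectDevissage

end
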